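import Literature.Probability.RandomPlanarGeometry.HexSAWBrickWallKestenRelation
import Mathlib.Analysis.Normed.Ring.InfiniteSum
import Mathlib.Topology.Algebra.InfiniteSum.Real
import HarnessLib

/-!
# Brick-wall bridges of the hexagonal lattice graded by SPAN: the span renewal structure at `1/μ_ℍ`

Topic `Literature/Probability/RandomPlanarGeometry` (continues `HexSAWBrickWallRenewal.lean` (irreducible brick-wall bridges,
the first-renewal bijection behind `b_n(ℍ) = Σ_s λ_s(ℍ) b_{n-s}(ℍ)`) and `HexSAWBrickWallKestenRelation.lean`
(`HexBW.kestenRelation : Σ_k λ_k(ℍ) μ_ℍ^{-k} = 1`); lane «pcv-sawmu», door R93 «HEX-BW-BRIDGE-NULL», faces K93.1–K93.2 of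
planner a-idea-1 g14, ROUTES-G14 ed.8).  Sources: N. R. Beaton, *The critical surface fugacity of self-avoiding walks on a
rotated honeycomb lattice*, J. Phys. A 47 (2014) 075003 (arXiv:1210.0274), Appendix A: the renewal structure of bridges
crossing the honeycomb lattice PERPENDICULARLY to an edge class, graded by height — "Kesten's relation for irreducible
bridges on the hypercubic lattice can be adapted to our lattice without difficulty. It gives `Σ_{γ ∈ iSAPP} x_c^{|γ|} = 1`"
and (proof of Lemma 16) "`f_T := Σ_{γ ∈ iSAPP, H(γ) = T} x_c^{|γ|}` … `v_T = PP_T(x_c)` and `Σ_k k f_k = E_iSAPP(H(γ))`";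
N. Madras, G. Slade, *The Self-Avoiding Walk* (1993), §4.2, (4.2.2)–(4.2.4) pp. 90–91 (renewal equation and Kesten's
relation on `ℤ^d`); W. Feller, *An Introduction to Probability Theory* I (1968), XIII.3.

In the brick-wall frame of the tree (`HexBW.bridges n`: bridges of `ℍ` along coordinate `0`, Madras–Slade's definition
`0 = ω₀(0) < ω₀(i) ≤ ω₀(n)`), the SPAN of a bridge is its endpoint height `ω₀(n)`.  Spans add under the twisted
concatenation `HexBW.concat` (the twist does not touch heights), so the tree's first-renewal bijection refines to the
span-graded classes, and at the critical weight `μ_ℍ^{-n}` the span-graded generating functions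
`v_T = Σ_n #{n-step bridges of span T} μ_ℍ^{-n}`, `f_T = Σ_n #{n-step irreducible bridges of span T} μ_ℍ^{-n}` form a
RENEWAL SEQUENCE: `v_0 = 1`, `v_T = Σ_{k=1}^{T} f_k v_{T-k}` (`T ≥ 1`), `Σ_T f_T = 1`.  No strip input is needed for the
finiteness of `v_T`: it comes out of the renewal structure itself (`v_T ≤ 1` by induction).

## Contents (namespace `Literature.Probability.RandomPlanarGeometry.SAW.HexBW`, all PROVED, no hypotheses)

* `spanBridges n T`, `spanIrreducibleBridges n T` (filters of the tree classes by `ω n 0 = T`), emptiness above the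
  diagonal (`T > n`), `sum_card_spanBridges` / `sum_card_spanIrreducibleBridges` (regrouping `b_n`, `λ_n` by span);
* **`card_spanBridges_eq_sum`** (K93.1, combinatorial) — for `T ≥ 1` and every `n`:
  `#spanBridges n T = Σ_{k ∈ range (T+1)} Σ_{s ∈ range (n+1)} #spanIrr s k · #spanBridges (n-s) (T-k)`;
* `bwSpanTerm T n = #spanBridges n T / μ_ℍ^n`, `bwIrrSpanTerm`, **`bwSpanV T = v_T`**, **`bwSpanF T = f_T`** (tsums over the
  length), `summable_bwSpanTerm`, `summable_bwIrrSpanTerm`, `bwSpanV_zero : v_0 = 1`, `bwSpanF_zero : f_0 = 0`,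
  **`bwSpanV_eq_sum`** (K93.1, analytic) — `v_T = Σ_{k ∈ range (T+1)} f_k v_{T-k}` for `T ≥ 1`, `bwSpanV_le_one`;
* **`hasSum_bwSpanF`** (K93.2) — `Σ_T f_T = 1` (Kesten's relation regrouped by span, Tonelli);
* `summable_mul_bwSpanF_of_summable` — `Σ_k k λ_k μ^{-k} < ∞ ⇒ Σ_T T f_T < ∞` (span ≤ length), the comparison used
  contrapositively by `HexSAWBrickWallBridgeNullBeaton.lean`.
-/

noncomputable section

open Finset Filter Topology Function Literature.Probability.LatticeModels Literature.Probability.Percolation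
  SimpleGraph
open scoped BigOperators

namespace Literature.Probability.RandomPlanarGeometry.SAW

namespace HexBW

/-! ### Span-graded classes -/

open Classical in
/-- The `n`-step brick-wall bridges of `ℍ` of SPAN `T` (endpoint height `ω₀(n) = T`).
[cite: Beaton2014RotatedHoneycomb, Appendix A (PP-bridges of height T)] -/
def spanBridges (n T : ℕ) : Finset (ℕ → Site 2) := (bridges n).filter fun ω => ω n 0 = T

open Classical in
/-- The `n`-step irreducible brick-wall bridges of `ℍ` of span `T`.
[cite: Beaton2014RotatedHoneycomb, Appendix A (irreducible PP-bridges of height T)] -/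
def spanIrreducibleBridges (n T : ℕ) : Finset (ℕ → Site 2) := (irreducibleBridges n).filter fun ω => ω n 0 = T

/-- Membership in `spanBridges`. [cite: Beaton2014RotatedHoneycomb, Appendix A] -/
theorem mem_spanBridges {n T : ℕ} {ω : ℕ → Site 2} : ω ∈ spanBridges n T ↔ ω ∈ bridges n ∧ ω n 0 = T := by
  classical
  exact Finset.mem_filter

/-- Membership in `spanIrreducibleBridges`. [cite: Beaton2014RotatedHoneycomb, Appendix A] -/
theorem mem_spanIrreducibleBridges {n T : ℕ} {ω : ℕ → Site 2} :
    ω ∈ spanIrreducibleBridges n T ↔ ω ∈ irreducibleBridges n ∧ ω n 0 = T := by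
  classical
  exact Finset.mem_filter

/-- The span of an `n`-step bridge is at most `n`. [cite: MadrasSlade1993, §1.2, Definition 1.2.4] -/
theorem span_le_of_mem_bridges {n : ℕ} {ω : ℕ → Site 2} (hω : ω ∈ bridges n) : ω n 0 ≤ n := by
  obtain ⟨h0, -, hadj, -⟩ := Zd.mem_saws.1 (bridges_subset_zd n hω |> fun h => (Zd.mem_bridges.1 h).1)
  exact (abs_le.1 (Zd.abs_apply_le_of_adj h0 hadj n le_rfl 0)).2

/-- The span of an `n`-step bridge is nonnegative, and positive when `n ≥ 1`. [cite: MadrasSlade1993, §1.2, Definition 1.2.4] -/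
theorem span_nonneg_of_mem_bridges {n : ℕ} {ω : ℕ → Site 2} (hω : ω ∈ bridges n) : 0 ≤ ω n 0 := by
  obtain ⟨hZ, hb⟩ := Zd.mem_bridges.1 (bridges_subset_zd n hω)
  have h0 : ω 0 = 0 := (Zd.mem_saws.1 hZ).1
  rcases Nat.eq_zero_or_pos n with rfl | hn
  · rw [h0]; exact le_rfl
  · have := (hb n hn le_rfl).1
    rw [h0] at this
    exact le_of_lt this

/-- For `n ≥ 1` the span of an `n`-step bridge is at least `1`. [cite: MadrasSlade1993, §1.2, Definition 1.2.4] -/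
theorem one_le_span_of_mem_bridges {n : ℕ} {ω : ℕ → Site 2} (hω : ω ∈ bridges n) (hn : 1 ≤ n) : 1 ≤ ω n 0 := by
  obtain ⟨hZ, hb⟩ := Zd.mem_bridges.1 (bridges_subset_zd n hω)
  have h0 : ω 0 = 0 := (Zd.mem_saws.1 hZ).1
  have := (hb n hn le_rfl).1
  rw [h0] at this
  exact this

/-- No `n`-step bridge has span `> n`. [cite: MadrasSlade1993, §1.2, Definition 1.2.4] -/
theorem spanBridges_eq_empty {n T : ℕ} (h : n < T) : spanBridges n T = ∅ := by
  refine Finset.eq_empty_iff_forall_notMem.2 fun ω hω => ?_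
  obtain ⟨hb, hT⟩ := mem_spanBridges.1 hω
  have := span_le_of_mem_bridges hb
  omega

/-- No `n`-step irreducible bridge has span `> n`. [cite: MadrasSlade1993, §4.2, Definition 4.2.1] -/
theorem spanIrreducibleBridges_eq_empty {n T : ℕ} (h : n < T) : spanIrreducibleBridges n T = ∅ := by
  refine Finset.eq_empty_iff_forall_notMem.2 fun ω hω => ?_
  obtain ⟨hb, hT⟩ := mem_spanIrreducibleBridges.1 hω
  have := span_le_of_mem_bridges (irreducibleBridges_subset_bridges n hb)
  omega

/-- Irreducible bridges have positive span: the span-`0` class is empty. [cite: MadrasSlade1993, §4.2, Definition 4.2.1] -/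
theorem spanIrreducibleBridges_zero (n : ℕ) : spanIrreducibleBridges n 0 = ∅ := by
  refine Finset.eq_empty_iff_forall_notMem.2 fun ω hω => ?_
  obtain ⟨hb, hT⟩ := mem_spanIrreducibleBridges.1 hω
  have hn : 1 ≤ n := (mem_irreducibleBridges.1 hb).2.1
  have := one_le_span_of_mem_bridges (irreducibleBridges_subset_bridges n hb) hn
  omega

/-- The only bridge of span `0` is the `0`-step bridge: `#spanBridges n 0 = [n = 0]`. [cite: MadrasSlade1993, §1.2, Definition 1.2.4] -/
theorem card_spanBridges_zero (n : ℕ) : #(spanBridges n 0) = if n = 0 then 1 else 0 := by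
  split_ifs with hn
  · subst hn
    rw [Finset.card_eq_one]
    refine ⟨Zd.straightWalk 2 0, Finset.eq_singleton_iff_unique_mem.2 ⟨?_, fun ω hω => ?_⟩⟩
    · refine mem_spanBridges.2 ⟨straightWalk_mem_bridges 0, by simp [Zd.straightWalk]⟩
    · obtain ⟨hb, -⟩ := mem_spanBridges.1 hω
      obtain ⟨h0, hend, -, -⟩ := Zd.mem_saws.1 (Zd.mem_bridges.1 (bridges_subset_zd 0 hb)).1
      funext i
      rw [hend i (Nat.zero_le i), h0]
      simp [Zd.straightWalk]
  · refine Finset.card_eq_zero.2 (Finset.eq_empty_iff_forall_notMem.2 fun ω hω => ?_)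
    obtain ⟨hb, hT⟩ := mem_spanBridges.1 hω
    have := one_le_span_of_mem_bridges hb (by omega)
    omega

/-- Regrouping `b_n(ℍ)` by span: `Σ_{T ∈ range (n+1)} #spanBridges n T = b_n(ℍ)`. [cite: Beaton2014RotatedHoneycomb, Appendix A] -/
theorem sum_card_spanBridges (n : ℕ) : ∑ T ∈ range (n + 1), #(spanBridges n T) = bridgeCount n := by
  classical
  rw [bridgeCount]
  have hmaps : ∀ ω ∈ bridges n, (ω n 0).toNat ∈ range (n + 1) := fun ω hω => by
    rw [mem_range]
    have h1 := span_le_of_mem_bridges hω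
    have h2 := span_nonneg_of_mem_bridges hω
    omega
  rw [Finset.card_eq_sum_card_fiberwise hmaps]
  refine Finset.sum_congr rfl fun T _ => ?_
  rw [spanBridges]
  congr 1
  ext ω
  simp only [Finset.mem_filter, and_congr_right_iff]
  intro hω
  have h2 := span_nonneg_of_mem_bridges hω
  omega

/-- Regrouping `λ_n(ℍ)` by span: `Σ_{T ∈ range (n+1)} #spanIrreducibleBridges n T = λ_n(ℍ)`. [cite: Beaton2014RotatedHoneycomb, Appendix A] -/
theorem sum_card_spanIrreducibleBridges (n : ℕ) :
    ∑ T ∈ range (n + 1), #(spanIrreducibleBridges n T) = irreducibleBridgeCount n := by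
  classical
  rw [irreducibleBridgeCount]
  have hmaps : ∀ ω ∈ irreducibleBridges n, (ω n 0).toNat ∈ range (n + 1) := fun ω hω => by
    rw [mem_range]
    have hb := irreducibleBridges_subset_bridges n hω
    have h1 := span_le_of_mem_bridges hb
    have h2 := span_nonneg_of_mem_bridges hb
    omega
  rw [Finset.card_eq_sum_card_fiberwise hmaps]
  refine Finset.sum_congr rfl fun T _ => ?_
  rw [spanIrreducibleBridges]
  congr 1
  ext ω
  simp only [Finset.mem_filter, and_congr_right_iff]
  intro hω
  have h2 := span_nonneg_of_mem_bridges (irreducibleBridges_subset_bridges n hω)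
  omega

/-! ### Spans add under the twisted concatenation; the first-renewal bijection refined by span (K93.1) -/

/-- Heights (hence spans) add under `HexBW.concat`: `(concat m ω υ) (m + j) 0 = ω m 0 + υ j 0` (the parity twist fixes
the height coordinate). [cite: MadrasSlade1993, §1.2, eq. (1.2.15)] -/
theorem concat_apply_add_zero (m : ℕ) (ω υ : ℕ → Site 2) (hυ : υ 0 = 0) (j : ℕ) :
    concat m ω υ (m + j) 0 = ω m 0 + υ j 0 := by
  have h0 : (fun j => twistAt (ω m) (υ j)) 0 = 0 := by simp [hυ]
  rw [concat, Zd.concatWalk_apply_add _ _ h0, Pi.add_apply, twistAt_apply_zero]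

/-- **K93.1 (combinatorial form): the span-graded renewal decomposition.** For `T ≥ 1` and every `n`,
`#spanBridges n T = Σ_{k ∈ range (T+1)} Σ_{s ∈ range (n+1)} #spanIrreducibleBridges s k · #spanBridges (n-s) (T-k)`:
the tree's first-renewal bijection `(s, η, τ) ↦ HexBW.concat s η τ` (`HexSAWBrickWallRenewal.lean`) carries
(span `k`, span `T-k`) to span `T`; the `s = 0` and `k = 0` terms vanish (`λ_0 = 0`, irreducible bridges have positive
span). [cite: Beaton2014RotatedHoneycomb, Appendix A (proof of Lemma 16); MadrasSlade1993, §4.2, eq. (4.2.2) (p. 90)] -/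
theorem card_spanBridges_eq_sum {T : ℕ} (hT : 1 ≤ T) (n : ℕ) :
    #(spanBridges n T) = ∑ k ∈ range (T + 1), ∑ s ∈ range (n + 1),
      #(spanIrreducibleBridges s k) * #(spanBridges (n - s) (T - k)) := by
  classical
  -- the index set: pairs `(k, s)` with the fibre `spanIrr s k × spanBridges (n-s) (T-k)`
  have hcard : #((range (T + 1) ×ˢ range (n + 1)).sigma
      fun ks => spanIrreducibleBridges ks.2 ks.1 ×ˢ spanBridges (n - ks.2) (T - ks.1)) =
      ∑ k ∈ range (T + 1), ∑ s ∈ range (n + 1), #(spanIrreducibleBridges s k) * #(spanBridges (n - s) (T - k)) := by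
    rw [card_sigma, Finset.sum_product]
    simp_rw [card_product]
  rw [← hcard]
  symm
  refine card_nbij (fun p => concat p.1.2 p.2.1 p.2.2) ?_ ?_ ?_
  · -- the gluing lands in the `n`-step bridges of span `T`
    rintro ⟨⟨k, s⟩, η, τ⟩ hp
    simp only [mem_coe, mem_sigma, mem_product, mem_range] at hp
    obtain ⟨⟨hk, hs⟩, hη, hτ⟩ := hp
    obtain ⟨hηi, hηk⟩ := mem_spanIrreducibleBridges.1 hη
    obtain ⟨hτb, hτk⟩ := mem_spanBridges.1 hτ
    have hηb := irreducibleBridges_subset_bridges s hηi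
    -- `s ≤ n`: otherwise `τ` would be a bridge of negative length; but `n - s` is a natural number, and we need
    -- `s + (n - s) = n`, which holds as soon as `s ≤ n`; if `s > n` then `τ ∈ bridges 0` has span `0 = T - k`, so
    -- `k = T ≥ 1`... we avoid this case analysis by reading `s ≤ n` off `hs : s < n + 1`.
    have hsn : s ≤ n := by omega
    rw [mem_coe, mem_spanBridges]
    have h := concat_mem_bridges hηb hτb
    rw [Nat.add_sub_cancel' hsn] at h
    refine ⟨h, ?_⟩
    have hτ0 : τ 0 = 0 := (Zd.mem_saws.1 (Zd.mem_bridges.1 (bridges_subset_zd _ hτb)).1).1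
    have e : n = s + (n - s) := by omega
    show concat s η τ n 0 = T
    rw [e, concat_apply_add_zero s η τ hτ0, hηk, hτk]
    omega
  · -- injectivity: the gluing time is the first renewal time, then the pieces are determined
    rintro ⟨⟨k, s⟩, η, τ⟩ hp ⟨⟨k', s'⟩, η', τ'⟩ hp' h
    simp only [mem_coe, mem_sigma, mem_product, mem_range] at hp hp'
    obtain ⟨⟨-, hs⟩, hη, hτ⟩ := hp
    obtain ⟨⟨-, hs'⟩, hη', hτ'⟩ := hp'
    dsimp only at h
    have hsn : s ≤ n := by omega
    have hsn' : s' ≤ n := by omega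
    obtain ⟨hηi, hηk⟩ := mem_spanIrreducibleBridges.1 hη
    obtain ⟨hηi', hηk'⟩ := mem_spanIrreducibleBridges.1 hη'
    obtain ⟨hτb, -⟩ := mem_spanBridges.1 hτ
    obtain ⟨hτb', -⟩ := mem_spanBridges.1 hτ'
    have hs1 : 1 ≤ s := (mem_irreducibleBridges.1 hηi).2.1
    have hs1' : 1 ≤ s' := (mem_irreducibleBridges.1 hηi').2.1
    have hηb := irreducibleBridges_subset_bridges s hηi
    have hηb' := irreducibleBridges_subset_bridges s' hηi'
    have hηZ : η ∈ Zd.saws 2 s := (mem_saws.1 (mem_bridges.1 hηb).1).1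
    have hηZ' : η' ∈ Zd.saws 2 s' := (mem_saws.1 (mem_bridges.1 hηb').1).1
    have hτZ : τ ∈ Zd.saws 2 (n - s) := (mem_saws.1 (mem_bridges.1 hτb).1).1
    have hτZ' : τ' ∈ Zd.saws 2 (n - s') := (mem_saws.1 (mem_bridges.1 hτb').1).1
    set σ : ℕ → Site 2 := fun j => twistAt (η s) (τ j) with hσ
    set σ' : ℕ → Site 2 := fun j => twistAt (η' s') (τ' j) with hσ'
    have hσZ : σ ∈ Zd.saws 2 (n - s) := twistAt_comp_mem_zdSaws (η s) hτZ
    have hσZ' : σ' ∈ Zd.saws 2 (n - s') := twistAt_comp_mem_zdSaws (η' s') hτZ'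
    have hσb : σ ∈ Zd.bridges 2 (n - s) :=
      Zd.mem_bridges.2 ⟨hσZ, (isBridge_twistAt_comp_iff (η s)).2 (mem_bridges.1 hτb).2⟩
    have hσb' : σ' ∈ Zd.bridges 2 (n - s') :=
      Zd.mem_bridges.2 ⟨hσZ', (isBridge_twistAt_comp_iff (η' s')).2 (mem_bridges.1 hτb').2⟩
    have hce : concat s η τ = Zd.concatWalk s η σ := rfl
    have hce' : concat s' η' τ' = Zd.concatWalk s' η' σ' := rfl
    rw [hce, hce'] at h
    have hren := Zd.isRenewalTime_concatWalk hsn (bridges_subset_zd s hηb) hσb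
    have hren' := Zd.isRenewalTime_concatWalk hsn' (bridges_subset_zd s' hηb') hσb'
    obtain rfl : s = s' := by
      by_contra hne
      rcases lt_or_gt_of_ne hne with hlt | hlt
      · rw [h] at hren
        exact Zd.not_isRenewalTime_concatWalk_of_lt hsn' (irreducibleBridges_subset_zd s' hηi') hs1 hlt hren
      · rw [← h] at hren'
        exact Zd.not_isRenewalTime_concatWalk_of_lt hsn (irreducibleBridges_subset_zd s hηi) hs1' hlt hren'
    obtain ⟨h1, h2⟩ := Zd.concatWalk_injective_pieces hηZ hσZ hηZ' hσZ' h
    subst h1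
    have hττ' : τ = τ' := by
      funext j
      have hj := congrFun h2 j
      simp only [hσ, hσ'] at hj
      exact twistAt_injective _ hj
    subst hττ'
    obtain rfl : k = k' := by
      have : (k : ℤ) = k' := by rw [← hηk, ← hηk']
      exact_mod_cast this
    rfl
  · -- surjectivity: split a bridge of span `T` at its first renewal time and twist the tail
    intro ω hω
    rw [mem_coe] at hω
    obtain ⟨hωb, hωT⟩ := mem_spanBridges.1 hω
    have hn : 1 ≤ n := by
      by_contra h0
      have : n = 0 := by omega
      subst this
      have := card_spanBridges_zero 0
      simp only [if_true] at this
      have hmem : ω ∈ spanBridges 0 0 := by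
        refine mem_spanBridges.2 ⟨hωb, ?_⟩
        obtain ⟨h0, -, -, -⟩ := Zd.mem_saws.1 (Zd.mem_bridges.1 (bridges_subset_zd 0 hωb)).1
        rw [h0]; rfl
      have hT0 : (T : ℤ) = 0 := by rw [← hωT]; exact (mem_spanBridges.1 hmem).2
      omega
    obtain ⟨s, hs1, hs, hmin⟩ := Zd.exists_first_renewalTime hn (mem_bridges.1 hωb).2
    have hsn : s ≤ n := hs.1
    set η : ℕ → Site 2 := fun i => ω (min i s) with hηdef
    set τ : ℕ → Site 2 := fun j => twistAt (ω s) (ω (s + j) - ω s) with hτdef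
    have hηi : η ∈ irreducibleBridges s := head_mem_irreducibleBridges hωb hs1 hs hmin
    have hτb : τ ∈ bridges (n - s) := tailTwist_mem_bridges hωb hs
    have hηs : η s 0 = ω s 0 := by simp [hηdef]
    have hτe : τ (n - s) 0 = ω n 0 - ω s 0 := by
      simp only [hτdef, twistAt_apply_zero, Pi.sub_apply, Nat.add_sub_cancel' hsn]
    -- the span `k = ω s 0` of the head is in `[1, T]`
    have hk1 : 1 ≤ ω s 0 := by
      have := ((mem_bridges.1 hωb).2 s hs1 hsn).1
      obtain ⟨h0, -, -, -⟩ := Zd.mem_saws.1 (Zd.mem_bridges.1 (bridges_subset_zd n hωb)).1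
      rw [h0] at this; exact this
    have hkT : ω s 0 ≤ T := by
      have := ((mem_bridges.1 hωb).2 s hs1 hsn).2
      rw [hωT] at this; exact this
    refine ⟨⟨⟨(ω s 0).toNat, s⟩, η, τ⟩, ?_, concat_head_tailTwist s ω⟩
    simp only [mem_coe, mem_sigma, mem_product, mem_range]
    refine ⟨⟨by omega, by omega⟩, mem_spanIrreducibleBridges.2 ⟨hηi, ?_⟩, mem_spanBridges.2 ⟨hτb, ?_⟩⟩
    · rw [hηs]; omega
    · rw [hτe, hωT]; omega

/-! ### The span generating functions at the critical weight `μ_ℍ^{-n}` -/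

/-- The terms `#spanBridges n T · μ_ℍ^{-n}` of `v_T`. [cite: Beaton2014RotatedHoneycomb, Appendix A (proof of Lemma 16)] -/
def bwSpanTerm (T n : ℕ) : ℝ := (#(spanBridges n T) : ℝ) / hexConnectiveConstant ^ n

/-- The terms `#spanIrreducibleBridges n T · μ_ℍ^{-n}` of `f_T`. [cite: Beaton2014RotatedHoneycomb, Appendix A (proof of Lemma 16)] -/
def bwIrrSpanTerm (T n : ℕ) : ℝ := (#(spanIrreducibleBridges n T) : ℝ) / hexConnectiveConstant ^ n

/-- **`v_T`**: the generating function of brick-wall bridges of `ℍ` of span `T` at the critical weight,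
`v_T = Σ_n #{n-step bridges of span T} μ_ℍ^{-n}` (Beaton's `v_T = PP_T(x_c)` in the brick-wall dress).
[cite: Beaton2014RotatedHoneycomb, Appendix A (proof of Lemma 16)] -/
def bwSpanV (T : ℕ) : ℝ := ∑' n : ℕ, bwSpanTerm T n

/-- **`f_T`**: the same over irreducible bridges, `f_T = Σ_n #{n-step irreducible bridges of span T} μ_ℍ^{-n}`
(Beaton's `f_T := Σ_{γ ∈ iSAPP, H(γ) = T} x_c^{|γ|}`). [cite: Beaton2014RotatedHoneycomb, Appendix A (proof of Lemma 16)] -/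
def bwSpanF (T : ℕ) : ℝ := ∑' n : ℕ, bwIrrSpanTerm T n

/-- `0 ≤ #spanBridges n T μ^{-n}`. [cite: Beaton2014RotatedHoneycomb, Appendix A] -/
theorem bwSpanTerm_nonneg (T n : ℕ) : 0 ≤ bwSpanTerm T n := by
  unfold bwSpanTerm
  exact div_nonneg (Nat.cast_nonneg _) (pow_nonneg hexConnectiveConstant_pos.le _)

/-- `0 ≤ #spanIrreducibleBridges n T μ^{-n}`. [cite: Beaton2014RotatedHoneycomb, Appendix A] -/
theorem bwIrrSpanTerm_nonneg (T n : ℕ) : 0 ≤ bwIrrSpanTerm T n := by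
  unfold bwIrrSpanTerm
  exact div_nonneg (Nat.cast_nonneg _) (pow_nonneg hexConnectiveConstant_pos.le _)

/-- `#spanIrreducibleBridges n T μ^{-n} ≤ λ_n μ^{-n}`. [cite: Beaton2014RotatedHoneycomb, Appendix A] -/
theorem bwIrrSpanTerm_le (T n : ℕ) :
    bwIrrSpanTerm T n ≤ (irreducibleBridgeCount n : ℝ) / hexConnectiveConstant ^ n := by
  unfold bwIrrSpanTerm
  refine div_le_div_of_nonneg_right ?_ (pow_nonneg hexConnectiveConstant_pos.le _)
  rw [irreducibleBridgeCount]
  exact_mod_cast Finset.card_le_card (Finset.filter_subset _ _)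

/-- The irreducible span terms are summable in the length (dominated by Kesten's series).
[cite: Beaton2014RotatedHoneycomb, Appendix A; MadrasSlade1993, §4.2, eq. (4.2.4)] -/
theorem summable_bwIrrSpanTerm (T : ℕ) : Summable (bwIrrSpanTerm T) :=
  Summable.of_nonneg_of_le (bwIrrSpanTerm_nonneg T) (bwIrrSpanTerm_le T) kestenRelation.summable

/-- `0 ≤ f_T`. [cite: Beaton2014RotatedHoneycomb, Appendix A] -/
theorem bwSpanF_nonneg (T : ℕ) : 0 ≤ bwSpanF T := tsum_nonneg (bwIrrSpanTerm_nonneg T)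

/-- `0 ≤ v_T`. [cite: Beaton2014RotatedHoneycomb, Appendix A] -/
theorem bwSpanV_nonneg (T : ℕ) : 0 ≤ bwSpanV T := tsum_nonneg (bwSpanTerm_nonneg T)

/-- `f_0 = 0` (irreducible bridges have positive span). [cite: Beaton2014RotatedHoneycomb, Appendix A] -/
theorem bwSpanF_zero : bwSpanF 0 = 0 := by
  unfold bwSpanF bwIrrSpanTerm
  simp [spanIrreducibleBridges_zero]

/-- The span-`0` terms: `[n = 0]`. [cite: Beaton2014RotatedHoneycomb, Appendix A] -/
theorem bwSpanTerm_zero (n : ℕ) : bwSpanTerm 0 n = if n = 0 then 1 else 0 := by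
  unfold bwSpanTerm
  rw [card_spanBridges_zero]
  split_ifs with h
  · subst h; simp
  · simp

/-- `v_0 = 1` (only the empty bridge has span `0`). [cite: Beaton2014RotatedHoneycomb, Appendix A] -/
theorem bwSpanV_zero : bwSpanV 0 = 1 := by
  unfold bwSpanV
  have h : ∀ n, bwSpanTerm 0 n = if n = 0 then 1 else 0 := bwSpanTerm_zero
  rw [tsum_congr h, tsum_ite_eq]

/-! ### K93.2: Kesten's relation regrouped by span, `Σ_T f_T = 1` -/

/-- The family `(n, T) ↦ #spanIrreducibleBridges n T μ^{-n}` on `ℕ × ℕ` has sum `1`: for each `n` the `T`-sum is the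
finite sum `λ_n μ^{-n}` (`sum_card_spanIrreducibleBridges`), and `Σ_n λ_n μ^{-n} = 1` is `HexBW.kestenRelation`;
nonnegativity makes the double family summable (`summable_prod_of_nonneg`). [cite: Beaton2014RotatedHoneycomb, Appendix A (display after "It gives"); MadrasSlade1993, §4.2, eq. (4.2.4) (p. 91)] -/
theorem hasSum_bwIrrSpanTerm_prod : HasSum (fun p : ℕ × ℕ => bwIrrSpanTerm p.2 p.1) 1 := by
  -- row sums: for fixed `n`, `Σ_T bwIrrSpanTerm T n = λ_n μ^{-n}` (finitely many nonzero terms)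
  have hrow : ∀ n : ℕ, HasSum (fun T : ℕ => bwIrrSpanTerm T n)
      ((irreducibleBridgeCount n : ℝ) / hexConnectiveConstant ^ n) := by
    intro n
    have hfin : ∀ T ∉ range (n + 1), bwIrrSpanTerm T n = 0 := by
      intro T hT
      rw [mem_range, not_lt] at hT
      unfold bwIrrSpanTerm
      rw [spanIrreducibleBridges_eq_empty (by omega)]
      simp
    have h : HasSum (fun T : ℕ => bwIrrSpanTerm T n) (∑ T ∈ range (n + 1), bwIrrSpanTerm T n) :=
      hasSum_sum_of_ne_finset_zero hfin
    have e : ∑ T ∈ range (n + 1), bwIrrSpanTerm T n = (irreducibleBridgeCount n : ℝ) / hexConnectiveConstant ^ n := by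
      unfold bwIrrSpanTerm
      rw [← Finset.sum_div, ← Nat.cast_sum, sum_card_spanIrreducibleBridges]
    rwa [e] at h
  have hnn : 0 ≤ fun p : ℕ × ℕ => bwIrrSpanTerm p.2 p.1 := fun p => bwIrrSpanTerm_nonneg _ _
  have hsum : Summable fun p : ℕ × ℕ => bwIrrSpanTerm p.2 p.1 := by
    rw [summable_prod_of_nonneg hnn]
    refine ⟨fun n => (hrow n).summable, ?_⟩
    simp_rw [fun n => (hrow n).tsum_eq]
    exact kestenRelation.summable
  -- identify the sum of the double family via the `n`-fibres
  have h3 := hsum.hasSum.prod_fiberwise fun n => (hrow n)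
  have e : (∑' p : ℕ × ℕ, bwIrrSpanTerm p.2 p.1) = 1 := h3.unique kestenRelation
  rw [← e]
  exact hsum.hasSum

/-- **K93.2 — Kesten's relation by span**: `Σ_T f_T = 1`, i.e. at the critical weight the irreducible brick-wall
bridges, graded by SPAN, form a probability distribution (Beaton: "It gives `Σ_{γ ∈ iSAPP} x_c^{|γ|} = 1`. This enables
us to define a probability measure `P_iSAPP`").  Tree input: `HexBW.kestenRelation` (graded by length), regrouped.
[cite: Beaton2014RotatedHoneycomb, Appendix A (display after "It gives"); MadrasSlade1993, §4.2, eq. (4.2.4) (p. 91)] -/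
theorem hasSum_bwSpanF : HasSum bwSpanF 1 := by
  have h := hasSum_bwIrrSpanTerm_prod
  -- swap the factors and sum the `T`-fibres
  have hswap : HasSum (fun p : ℕ × ℕ => bwIrrSpanTerm p.1 p.2) 1 := by
    have := (Equiv.prodComm ℕ ℕ).hasSum_iff.2 h
    exact this
  exact hswap.prod_fiberwise fun T => (summable_bwIrrSpanTerm T).hasSum

/-- `Σ_T f_T` over any finite set is at most `1`. [cite: Beaton2014RotatedHoneycomb, Appendix A] -/
theorem sum_bwSpanF_le_one (s : Finset ℕ) : ∑ T ∈ s, bwSpanF T ≤ 1 :=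
  (hasSum_bwSpanF.summable.sum_le_tsum s fun T _ => bwSpanF_nonneg T).trans hasSum_bwSpanF.tsum_eq.le

/-! ### K93.1 (analytic form): `v_T = Σ_k f_k v_{T-k}`, summability, `v_T ≤ 1` -/

/-- The termwise renewal identity at the critical weight: for `T ≥ 1` and every `n`,
`#spanBridges n T μ^{-n} = Σ_{k ∈ range (T+1)} Σ_{s ∈ range (n+1)} (#spanIrr s k μ^{-s}) (#spanBridges (n-s) (T-k) μ^{-(n-s)})`.
[cite: Beaton2014RotatedHoneycomb, Appendix A (proof of Lemma 16); MadrasSlade1993, §4.2, eq. (4.2.2)] -/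
theorem bwSpanTerm_eq_sum {T : ℕ} (hT : 1 ≤ T) (n : ℕ) :
    bwSpanTerm T n = ∑ k ∈ range (T + 1), ∑ s ∈ range (n + 1), bwIrrSpanTerm k s * bwSpanTerm (T - k) (n - s) := by
  have hμ : hexConnectiveConstant ≠ 0 := hexConnectiveConstant_pos.ne'
  unfold bwSpanTerm bwIrrSpanTerm
  rw [card_spanBridges_eq_sum hT n, Nat.cast_sum, Finset.sum_div]
  refine Finset.sum_congr rfl fun k _ => ?_
  rw [Nat.cast_sum, Finset.sum_div]
  refine Finset.sum_congr rfl fun s hs => ?_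
  have hsn : s ≤ n := Nat.lt_succ_iff.1 (mem_range.1 hs)
  rw [Nat.cast_mul, div_mul_div_comm, ← pow_add, Nat.add_sub_cancel' hsn]

/-- For nonnegative real sequences, summability of the norms is summability. [folklore] -/
private theorem summable_norm_of_nonneg' {g : ℕ → ℝ} (hg : ∀ n, 0 ≤ g n) (h : Summable g) :
    Summable fun n => ‖g n‖ := by
  refine h.congr fun n => ?_
  rw [Real.norm_of_nonneg (hg n)]

/-- **Summability of `v_T` and the renewal equation**, by induction on the span: for every `T`, the terms of `v_T` are
summable, and for `T ≥ 1`, `v_T = Σ_{k ∈ range (T+1)} f_k v_{T-k}` — the length-sum of the termwise identity is a finite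
sum of Cauchy products of summable nonnegative series (`k = 0` contributes nothing since `f`-terms of span `0` vanish,
so only `v_{T-k}` with `T - k < T` enter). [cite: Beaton2014RotatedHoneycomb, Appendix A (proof of Lemma 16); Feller1968, XIII.3] -/
theorem summable_bwSpanTerm_and_eq (T : ℕ) :
    Summable (bwSpanTerm T) ∧
      (1 ≤ T → bwSpanV T = ∑ k ∈ range (T + 1), bwSpanF k * bwSpanV (T - k)) := by
  induction T using Nat.strong_induction_on with
  | _ T ih =>
    rcases Nat.eq_zero_or_pos T with rfl | hT
    · refine ⟨?_, fun h => absurd h (by norm_num)⟩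
      have h : ∀ n, bwSpanTerm 0 n = if n = 0 then 1 else 0 := bwSpanTerm_zero
      rw [show bwSpanTerm 0 = fun n => if n = 0 then (1 : ℝ) else 0 from funext h]
      exact summable_of_ne_finset_zero (s := {0}) (by intro n hn; simp only [Finset.mem_singleton] at hn; simp [hn])
    · -- the Cauchy products `c_k(n) = Σ_{s ≤ n} fterm k s · vterm (T-k) (n-s)`, `k ∈ range (T+1)`
      have hk0 : ∀ n, ∑ s ∈ range (n + 1), bwIrrSpanTerm 0 s * bwSpanTerm (T - 0) (n - s) = 0 := by
        intro n
        refine Finset.sum_eq_zero fun s _ => ?_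
        unfold bwIrrSpanTerm
        rw [spanIrreducibleBridges_zero]; simp
      -- summability and sums of each Cauchy product with `k ≥ 1`
      have hprod : ∀ k ∈ range (T + 1), Summable (fun n => ∑ s ∈ range (n + 1),
          bwIrrSpanTerm k s * bwSpanTerm (T - k) (n - s)) ∧
          (∑' n, ∑ s ∈ range (n + 1), bwIrrSpanTerm k s * bwSpanTerm (T - k) (n - s)) =
            bwSpanF k * bwSpanV (T - k) := by
        intro k hk
        rcases Nat.eq_zero_or_pos k with rfl | hk1
        · refine ⟨(summable_zero).congr fun n => (hk0 n).symm, ?_⟩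
          rw [tsum_congr hk0, tsum_zero, bwSpanF_zero, zero_mul]
        · have hlt : T - k < T := by omega
          have hv := (ih (T - k) hlt).1
          have hf := summable_bwIrrSpanTerm k
          have hfn := summable_norm_of_nonneg' (bwIrrSpanTerm_nonneg k) hf
          have hvn := summable_norm_of_nonneg' (bwSpanTerm_nonneg (T - k)) hv
          have hH := hasSum_sum_range_mul_of_summable_norm hfn hvn
          exact ⟨hH.summable, hH.tsum_eq⟩
      have hterm : ∀ n, bwSpanTerm T n =
          ∑ k ∈ range (T + 1), ∑ s ∈ range (n + 1), bwIrrSpanTerm k s * bwSpanTerm (T - k) (n - s) :=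
        bwSpanTerm_eq_sum hT
      have hS : Summable (bwSpanTerm T) := by
        rw [show bwSpanTerm T = fun n => ∑ k ∈ range (T + 1), ∑ s ∈ range (n + 1),
          bwIrrSpanTerm k s * bwSpanTerm (T - k) (n - s) from funext hterm]
        exact summable_sum fun k hk => (hprod k hk).1
      refine ⟨hS, fun _ => ?_⟩
      unfold bwSpanV
      rw [tsum_congr hterm, Summable.tsum_finsetSum fun k hk => (hprod k hk).1]
      exact Finset.sum_congr rfl fun k hk => (hprod k hk).2

/-- The terms of `v_T` are summable in the length. [cite: Beaton2014RotatedHoneycomb, Appendix A (proof of Lemma 16)] -/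
theorem summable_bwSpanTerm (T : ℕ) : Summable (bwSpanTerm T) := (summable_bwSpanTerm_and_eq T).1

/-- **K93.1 — the span renewal equation**: `v_T = Σ_{k ∈ range (T+1)} f_k v_{T-k}` for `T ≥ 1` (`f_0 = 0`), the
perpendicular-frame honeycomb instance of Madras–Slade (4.2.2) / Beaton's "`v_T = PP_T(x_c)`" renewal structure.
[cite: Beaton2014RotatedHoneycomb, Appendix A (proof of Lemma 16); MadrasSlade1993, §4.2, eq. (4.2.2) (p. 90)] -/
theorem bwSpanV_eq_sum {T : ℕ} (hT : 1 ≤ T) : bwSpanV T = ∑ k ∈ range (T + 1), bwSpanF k * bwSpanV (T - k) :=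
  (summable_bwSpanTerm_and_eq T).2 hT

/-- **`v_T ≤ 1`** for every `T` (induction: `v_T = Σ_k f_k v_{T-k} ≤ (Σ_k f_k) · 1 ≤ 1`). In particular the
critical span generating functions are FINITE without any strip input. [cite: Beaton2014RotatedHoneycomb, Appendix A; Feller1968, XIII.3] -/
theorem bwSpanV_le_one (T : ℕ) : bwSpanV T ≤ 1 := by
  induction T using Nat.strong_induction_on with
  | _ T ih =>
    rcases Nat.eq_zero_or_pos T with rfl | hT
    · rw [bwSpanV_zero]
    · rw [bwSpanV_eq_sum hT]
      calc ∑ k ∈ range (T + 1), bwSpanF k * bwSpanV (T - k)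
          ≤ ∑ k ∈ range (T + 1), bwSpanF k * 1 := by
            refine Finset.sum_le_sum fun k _ => ?_
            rcases Nat.eq_zero_or_pos k with rfl | hk1
            · rw [bwSpanF_zero, zero_mul, zero_mul]
            · exact mul_le_mul_of_nonneg_left (ih (T - k) (by omega)) (bwSpanF_nonneg k)
        _ = ∑ k ∈ range (T + 1), bwSpanF k := by simp
        _ ≤ 1 := sum_bwSpanF_le_one _

/-! ### Span versus length: the comparison `Σ_T T f_T ≤ Σ_k k λ_k μ^{-k}` -/

/-- **If the critical irreducible bridges have finite mean LENGTH then they have finite mean SPAN**: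
`Summable (k ↦ k λ_k μ^{-k}) → Summable (T ↦ T f_T)` (span `≤` length on every nonempty class; Tonelli for the
nonnegative double family `(n, T) ↦ T #spanIrr n T μ^{-n} ≤ n #spanIrr n T μ^{-n}`).  Used contrapositively: infinite mean
span forces infinite mean length. [cite: Beaton2014RotatedHoneycomb, Appendix A (Lemma 16: "Σ_k k f_k = E_iSAPP(H(γ))"); MadrasSlade1993, §4.2] -/
theorem summable_mul_bwSpanF_of_summable
    (h : Summable fun k : ℕ => (k : ℝ) * ((irreducibleBridgeCount k : ℝ) / hexConnectiveConstant ^ k)) :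
    Summable fun T : ℕ => (T : ℝ) * bwSpanF T := by
  -- the dominating family `g' (n, T) = n · #spanIrr n T μ^{-n}` (finite `T`-support for each `n`)
  set g : ℕ × ℕ → ℝ := fun p => (p.2 : ℝ) * bwIrrSpanTerm p.2 p.1 with hg
  set g' : ℕ × ℕ → ℝ := fun p => (p.1 : ℝ) * bwIrrSpanTerm p.2 p.1 with hg'
  have hgnn : 0 ≤ g := fun p => mul_nonneg (Nat.cast_nonneg _) (bwIrrSpanTerm_nonneg _ _)
  have hg'nn : 0 ≤ g' := fun p => mul_nonneg (Nat.cast_nonneg _) (bwIrrSpanTerm_nonneg _ _)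
  -- `g ≤ g'`: a nonempty class `spanIrr n T` has `T ≤ n`
  have hle : ∀ p, g p ≤ g' p := by
    rintro ⟨n, T⟩
    simp only [hg, hg']
    by_cases hT : T ≤ n
    · exact mul_le_mul_of_nonneg_right (by exact_mod_cast hT) (bwIrrSpanTerm_nonneg _ _)
    · have : bwIrrSpanTerm T n = 0 := by
        unfold bwIrrSpanTerm; rw [spanIrreducibleBridges_eq_empty (by omega)]; simp
      rw [this, mul_zero, mul_zero]
  -- rows of `g'`: finite sums `n λ_n μ^{-n}`
  have hrow' : ∀ n : ℕ, HasSum (fun T : ℕ => g' (n, T))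
      ((n : ℝ) * ((irreducibleBridgeCount n : ℝ) / hexConnectiveConstant ^ n)) := by
    intro n
    have hfin : ∀ T ∉ range (n + 1), g' (n, T) = 0 := by
      intro T hT
      rw [mem_range, not_lt] at hT
      simp only [hg']
      unfold bwIrrSpanTerm
      rw [spanIrreducibleBridges_eq_empty (by omega)]
      simp
    have h1 : HasSum (fun T : ℕ => g' (n, T)) (∑ T ∈ range (n + 1), g' (n, T)) :=
      hasSum_sum_of_ne_finset_zero hfin
    have e : ∑ T ∈ range (n + 1), g' (n, T) = (n : ℝ) * ((irreducibleBridgeCount n : ℝ) / hexConnectiveConstant ^ n) := by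
      simp only [hg']
      rw [← Finset.mul_sum]
      congr 1
      unfold bwIrrSpanTerm
      rw [← Finset.sum_div, ← Nat.cast_sum, sum_card_spanIrreducibleBridges]
    rwa [e] at h1
  have hsum' : Summable g' := by
    rw [summable_prod_of_nonneg hg'nn]
    refine ⟨fun n => (hrow' n).summable, ?_⟩
    simp_rw [fun n => (hrow' n).tsum_eq]
    exact h
  have hsum : Summable g := Summable.of_nonneg_of_le hgnn hle hsum'
  -- columns of `g`: `T f_T`
  have hswap : Summable fun p : ℕ × ℕ => g (p.2, p.1) := (Equiv.prodComm ℕ ℕ).summable_iff.2 hsum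
  have hcol := hswap.prod
  refine hcol.congr fun T => ?_
  simp only [hg]
  rw [tsum_mul_left]
  rfl

end HexBW

end Literature.Probability.RandomPlanarGeometry.SAW
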